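import Summits.RiemannHypothesis.RiemannHypothesis.Theorems.WeilColumnYoungMoll
import Summits.RiemannHypothesis.RiemannHypothesis.Theorems.WeilColumnThetaArchBound
import HarnessLib

/-!
# Mollification does not increase the `L²` increment; D7 AT LEVEL `k` (RH-FREE; PR Step 5 of THETA-ASSIGN §6)

Cell `rh-explicit`, WEIL column, seat handoff-prove-2 gen12.  For `f : ℝ → ℂ` continuous with compact support:

* `weilConv_shift_left` : `((f(· + t)) ⋆ m)(x) = (f ⋆ m)(x + t)`;
* **`weilIncrement_weilConv_moll_le`** : `weilIncrement (f ⋆ φ_k) t ≤ weilIncrement f t` (Young in `L²` applied to `f(·+t) − f`);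
* **`ThetaParams.re_weilArchTerm_moll_le_arch`** : if `∫‖f‖² ≤ P.A` and `weilIncrement f t ≤ P.B·t²` on `(0, t₀]` (`0 < t₀ ≤ 1`) then
  `Re W_∞((f⋆φ_k) ⋆ (f⋆φ_k)~) ≤ P.arch t₀` for EVERY `k` — no derivative of the mollified function is ever needed.
Nothing here bears on the truth of RH.
-/

noncomputable section

set_option linter.dupNamespace false

open Complex Set MeasureTheory Filter Function
open scoped Real Topology

namespace Summit.RiemannHypothesis.RiemannHypothesis.Theorems.WeilColumn.ThetaMellin

open Literature.NumberTheory.LFunctions Literature.NumberTheory.LFunctions.WeilContinuous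

variable {f : ℝ → ℂ}

/-- `((f(· + t)) ⋆ m)(x) = (f ⋆ m)(x + t)`. -/
theorem weilConv_shift_left (f m : ℝ → ℂ) (t x : ℝ) :
    weilConv (fun u ↦ f (u + t)) m x = weilConv f m (x + t) := by
  rw [weilConv_apply, weilConv_apply, ← integral_add_right_eq_self (fun u ↦ f u * m (x + t - u)) t]
  refine integral_congr_ae (Eventually.of_forall fun u ↦ ?_)
  simp only
  rw [show x + t - (u + t) = x - u by ring]

/-- Integrability of `u ↦ f(u)·φ_k(x − u)` for `f` continuous of compact support. -/
theorem integrable_mul_moll (hfc : Continuous f) (hfs : HasCompactSupport f) (k : ℕ) (x : ℝ) :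
    Integrable fun u ↦ f u * moll k (x - u) :=
  (hfc.mul ((continuous_moll k).comp (continuous_const.sub continuous_id))).integrable_of_hasCompactSupport
    hfs.mul_right

/-- **Mollification does not increase the `L²` increment**: `weilIncrement (f ⋆ φ_k) t ≤ weilIncrement f t`. [folklore: Young] -/
theorem weilIncrement_weilConv_moll_le (hfc : Continuous f) (hfs : HasCompactSupport f) (k : ℕ) (t : ℝ) :
    weilIncrement (weilConv f (moll k)) t ≤ weilIncrement f t := by
  -- the difference function
  set d : ℝ → ℂ := fun u ↦ f (u + t) - f u with hd
  have hc1 : Continuous fun u : ℝ ↦ f (u + t) := hfc.comp (continuous_id.add continuous_const)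
  have hs1 : HasCompactSupport fun u : ℝ ↦ f (u + t) := hfs.comp_homeomorph (Homeomorph.addRight t)
  have hdc : Continuous d := hc1.sub hfc
  have hds : HasCompactSupport d := hs1.sub hfs
  have hconv : ∀ x, weilConv f (moll k) (x + t) - weilConv f (moll k) x = weilConv d (moll k) x := by
    intro x
    have i1 : Integrable (fun u ↦ f (u + t) * moll k (x - u)) := integrable_mul_moll hc1 hs1 k x
    have i2 : Integrable (fun u ↦ f u * moll k (x - u)) := integrable_mul_moll hfc hfs k x
    rw [← weilConv_shift_left f (moll k) t x, weilConv_apply, weilConv_apply, weilConv_apply,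
      ← integral_sub i1 i2]
    refine integral_congr_ae (Eventually.of_forall fun u ↦ ?_)
    simp only [hd]; ring
  unfold weilIncrement
  simp_rw [hconv]
  exact integral_norm_sq_weilConv_moll_le hdc hds k

namespace ThetaParams

variable (P : ThetaParams)

/-- **D7 at level `k`**: `Re W_∞((f⋆φ_k) ⋆ (f⋆φ_k)~) ≤ P.arch t₀` whenever `∫‖f‖² ≤ P.A`, `weilIncrement f t ≤ P.B·t²` on `(0,t₀]`,
`0 < t₀ ≤ 1`, for `f` continuous of compact support — uniformly in `k`. [THETA-CERT-cc6 §D7 + Young] -/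
theorem re_weilArchTerm_moll_le_arch (hfc : Continuous f) (hfs : HasCompactSupport f)
    (hA : ∫ x : ℝ, ‖f x‖ ^ 2 ≤ P.A) {t₀ : ℝ} (ht₀ : 0 < t₀) (ht₁ : t₀ ≤ 1)
    (hB : ∀ t ∈ Ioc (0 : ℝ) t₀, weilIncrement f t ≤ P.B * t ^ 2) (k : ℕ) :
    (weilArchTerm (weilConv (weilConv f (moll k)) (weilReflect (weilConv f (moll k))))).re ≤ P.arch t₀ := by
  have hg : IsWeilTest (weilConv f (moll k)) := isWeilTest_weilConv_moll hfc hfs k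
  have hA' : ∫ x : ℝ, ‖weilConv f (moll k) x‖ ^ 2 ≤ P.A := (integral_norm_sq_weilConv_moll_le hfc hfs k).trans hA
  have hB' : ∀ t ∈ Ioc (0 : ℝ) t₀, weilIncrement (weilConv f (moll k)) t ≤ P.B * t ^ 2 :=
    fun t ht ↦ (weilIncrement_weilConv_moll_le hfc hfs k t).trans (hB t ht)
  have h := ThetaArch.re_weilArchTerm_weilConv_weilReflect_le_of_sq_modulus hg hA' ht₀ hB'
  have h2 : 2 * weilArchTail t₀ ≤ Jexplicit t₀ := ThetaArch.two_mul_weilArchTail_le ht₀ ht₁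
  refine h.trans ?_
  have hA0 : 0 ≤ P.A := (integral_nonneg fun x ↦ sq_nonneg _).trans hA'
  unfold arch archC₁
  have h4 : 4 * weilArchTail t₀ ≤ 2 * Jexplicit t₀ := by linarith
  have hmax : max 0 (4 * weilArchTail t₀ - (Real.log (4 * π) + Real.eulerMascheroniConstant) - (π / 2 + Real.log 2)) ≤
      max 0 (2 * Jexplicit t₀ - Real.log (4 * π) - Real.eulerMascheroniConstant - (π / 2 + Real.log 2)) :=
    max_le_max le_rfl (by linarith)
  have := mul_le_mul_of_nonneg_left hmax hA0
  linarith

end ThetaParams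

end Summit.RiemannHypothesis.RiemannHypothesis.Theorems.WeilColumn.ThetaMellin

end
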